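import Summits.QuantumFields.BalabanUV.Beta.GAN24.SecondOrderLipschitz
import Summits.QuantumFields.BalabanUV.Beta.GAN24.ThirdJetKernel
import Literature.MathematicalPhysics.QuantumFieldTheory.Balaban1983to89.Beta.BalabanStepW2

/-!
# `BalabanUV.Beta.GAN24.ValueReadoutLipschitz` — THE VALUE READ-OUT IS LIPSCHITZ: an2's second response-derivative `K3OfK K N S M W`
# and its step-form read-out `mmRead N ∘ K3OfK` are Lipschitz in ALL FOUR data `(K, S, M, W)`
# (G-an2-4 formalisation swarm, leaf prover 08, gen 16; generic ENGINE toward the forcing `f_m` of the owner's END #2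
# `WSlotT2OfPieces.rate_of_rows` — journal INTENT «W3-K3LIP*»; name PROVISIONAL, the row owner gan24-p1 may rename or re-home it)

NOT IN PRINT; OUR PROOF (elementary).  HONEST FRAMING (cell contract, verbatim): «discharging `BetaPertH` makes Bałaban's UV stability
UNCONDITIONAL — a real constructive-QFT result; it is NOT the continuum limit and NOT the Clay problem.»  HONEST DEPENDENCY (verbatim):
«continuum YM on T⁴ ⇐ BetaPertH ∧ nine spine estimates (0/9 proved); BetaPertH ⇐ (D1) ∧ (D4) ∧ CAP+tail; G-an2-4 gates asym, D1 and
NE2/3/4.»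

WHAT.  an2's `Beta/BalabanStepW2` §4 defines the second response-derivative `K3OfK K N S M W b b′ := −K∘dM_b∘K2OfK_{b′} − K∘dM_{b′}∘K2OfK_b
− K∘W(b,b′)∘K` and proves its far-small localisation `biLoc_K3OfK_far` (ONE datum); leaf-03's engine `GAN24/SecondOrderLipschitz{,Bi,Resp,W2}`
proves that `dM`, `K2OfK`, the sandwich `K∘V∘K` and the CARRIER `W2SymOfK` are LIPSCHITZ in their data.  The normalised recursion of an2's
bi-stencil family reads the value 4-jet through `mmRead Lc ∘ K3OfK` (leaf-19's `T2SlotUnits.unitS₂_T2Of_succ_vh₂S`, leaf-04's affine split), so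
the DIFFERENCE tower of road W3 (SKELETON-W3 v0.2 §7.4 (F4)(f-rate) ∕ END #2 `WSlotT2OfPieces.rate_of_rows`, forcing `f_m`) needs the brick
this module supplies: **`K3OfK` and its `mm`-read-out are Lipschitz in `(K, S, M, W)` jointly**, EXPLICIT constant `lK3` LINEAR in the four
deviations (`lK3_mul`: geometric data deviations ⟹ geometric read-out deviations), ONE fixed output rate (`m/32` kernel, `m/128` read-out),
constants OUTSIDE every `∀` (RULINGS-12 (R12-2)).  HOW ([folklore]; every analytic brick BY NAME, none re-proved): an2's proof of
`biLoc_K3OfK_far` one order of differences up — the product terms telescope through asym1's `HessKerRate.biLoc_comp_sub_comp` (factor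
`K∘dM_b`, leaf-03's `vertexFamily_dM_sub`) and `biLoc_comp_sub_comp_bb` (factor `K2OfK_{b′}` at the OTHER bond, leaf-03's
`vertexFamily_K2OfK_sub`), re-centred by an2's `biLoc_recenter_left∕right`; the sandwich term is leaf-03's `biLoc_sandwich_sub` with the far
factor pulled through its bilinear constant.
* §1 `biLoc_K3OfK_sub_of_parts`, `lSand_mul_far`, `biLoc_sandwich_sub_far`;  §2 `lProd`, `lProd_nonneg`, **`biLoc_prod_sub`**;
* §3 `lK3`, `lK3_nonneg`, `lK3_mul`, **`biLoc_K3OfK_sub_far`** — THE ENGINE (an2's `biLoc_K3OfK_far` shape, token for token, one order up);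
* §4 **`locStencil₂_mmRead_K3OfK_sub`** (read-out form, leaf-19's `locStencil₂_mmRead_K3OfK_family` currency: pair-form swap-symmetric second
  tables, output `LocStencil₂ (…) (lK3 … (m/4)) (m/128)`), **`mmRead_K3OfK_cauchy`** (family form, leaf-03's `vertexFamily₂_W2SymOfK_cauchy`
  pattern: `j`-uniform data with `(k+j, k)`-deviations `c·θ^k` ⟹ read-out deviations `lK3(…, cK, cS, cM, cW, m/4)·θ^k`; no condition on `θ`).

HONEST: generic kernel algebra over an2's carriers; instantiates NO binder of the wall, asserts NO shape or rate of Bałaban's tables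
(«T2Shape» ∕ «T2SupRate» stay located ∕ OPEN), pins nothing, discharges NOTHING of (hW, hWall); NOT «W-slot closed», NEVER «G-an2-4
closed», NOT (CONV-C); NOT BetaPertH, NOT continuum, NOT Clay.  0 sorry, 0 cite, 0 `def … : Prop` (the two `def`s are explicit real
constants, leaf-03's `ldM`∕`lSand`∕`lK2` pattern).
-/

noncomputable section

open Finset
open scoped BigOperators
open Literature.MathematicalPhysics.QuantumFieldTheory
open Literature.MathematicalPhysics.QuantumFieldTheory.Balaban1983to89
open Literature.MathematicalPhysics.QuantumFieldTheory.Balaban1983to89.Beta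
open B12Sec2to5 (l1 l1_nonneg)
open ExpKernelCalculus (MKer Decays BiLoc VertexFamily VertexFamily₂ comp Zl Zl_nonneg l1_sub_symm biLoc_comp_decays biLoc_comp_biLoc)
open OneStepResolventKernel (Fib LocStencil decays_mono biLoc_mono bound_mono)
open KernelWard (biLoc_add)
open HessKerRate (biLoc_comp_sub_comp biLoc_comp_sub_comp_bb)
open BalabanStepJets (locStencil_mono vertexFamily₂_mono)
open BalabanStepJetsSucc (mmRead biLoc_mmRead l1_sub_le_l1_smul_sub)
open BalabanCompositeJets (LocStencil₂)
open SecondOrderResponse (dM K2OfK vertexFamily_dM vertexFamily_K2OfK cdM cK2 cdM_nonneg cK2_nonneg biLoc_recenter_left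
  biLoc_recenter_right)
open BalabanStepW2 (K3OfK vertexFamily_mono' biLoc_le_mono biLoc_far_of_pair abs_neg_sub_sub_le)
open Summit.QuantumFields.BalabanUV.Beta.GAN24.SecondOrderLipschitz (ldM ldM_nonneg lSand lSand_nonneg lK2 lK2_nonneg vertexFamily_dM_sub
  biLoc_sandwich_sub vertexFamily_K2OfK_sub)
open Summit.QuantumFields.BalabanUV.Beta.GAN24.ThirdJetKernel (mmRead_sub)

namespace Summit.QuantumFields.BalabanUV.Beta.GAN24.ValueReadoutLipschitz

variable {d : ℕ}

/-! ## §1 The three differences ⟹ the difference; the sandwich term with a far factor -/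

section Parts

variable {N : ℕ}

/-- [folklore] **THE DIFFERENCE OF TWO `K3OfK` FROM THE DIFFERENCES OF ITS THREE TERMS** (same centre pair and rate): if the two product
terms and the sandwich term of an2's `K3OfK` differ, between the data `(K, S, M, W)` and `(K′, S′, M′, W′)`, by kernels bi-localised at
`(p, q)` with constants `C₁, C₂, C₃`, then `K3OfK K … W b b′ − K3OfK K′ … W′ b b′` is bi-localised there with constant `C₁ + C₂ + C₃`
(`−a − b − c − (−a′ − b′ − c′) = −(a − a′) − (b − b′) − (c − c′)` and an2's `abs_neg_sub_sub_le`). -/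
theorem biLoc_K3OfK_sub_of_parts {K K' : MKer (d + 1) (Fib d)}
    {S M S' M' : Fin (d + 1) → (Fin (d + 1) → ℤ) → MKer (d + 1) (Fib d)}
    {W W' : Fin (d + 1) → (Fin (d + 1) → ℤ) → Fin (d + 1) → (Fin (d + 1) → ℤ) → MKer (d + 1) (Fib d)}
    {μ : Fin (d + 1)} {y : Fin (d + 1) → ℤ} {ν : Fin (d + 1)} {y' : Fin (d + 1) → ℤ} {p q : Fin (d + 1) → ℤ} {C₁ C₂ C₃ δ : ℝ}
    (hA : BiLoc (comp (comp K (dM K N S M μ y)) (K2OfK K N S M ν y') - comp (comp K' (dM K' N S' M' μ y)) (K2OfK K' N S' M' ν y'))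
      p q C₁ δ)
    (hB : BiLoc (comp (comp K (dM K N S M ν y')) (K2OfK K N S M μ y) - comp (comp K' (dM K' N S' M' ν y')) (K2OfK K' N S' M' μ y))
      p q C₂ δ)
    (hG : BiLoc (comp (comp K (W μ y ν y')) K - comp (comp K' (W' μ y ν y')) K') p q C₃ δ) :
    BiLoc (K3OfK K N S M W μ y ν y' - K3OfK K' N S' M' W' μ y ν y') p q (C₁ + C₂ + C₃) δ := by
  intro x z a b
  have e : (K3OfK K N S M W μ y ν y' - K3OfK K' N S' M' W' μ y ν y') x z a b =
      -((comp (comp K (dM K N S M μ y)) (K2OfK K N S M ν y') - comp (comp K' (dM K' N S' M' μ y)) (K2OfK K' N S' M' ν y')) x z a b)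
        - (comp (comp K (dM K N S M ν y')) (K2OfK K N S M μ y) - comp (comp K' (dM K' N S' M' ν y')) (K2OfK K' N S' M' μ y)) x z a b
        - (comp (comp K (W μ y ν y')) K - comp (comp K' (W' μ y ν y')) K') x z a b := by
    simp only [K3OfK, Pi.sub_apply]
    ring
  rw [e, add_mul, add_mul]
  exact (abs_neg_sub_sub_le _ _ _).trans (add_le_add (add_le_add (hA x z a b) (hB x z a b)) (hG x z a b))

/-- [folklore] leaf-03's sandwich Lipschitz constant is jointly LINEAR in (the constant of `V`, the deviation of `V`): a common factor of
both pulls out — how a far-decaying factor passes through `biLoc_sandwich_sub`. -/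
theorem lSand_mul_far (d : ℕ) (C CV εK εV m t : ℝ) : lSand d C (CV * t) εK (εV * t) m = lSand d C CV εK εV m * t := by
  unfold lSand; ring

/-- [folklore] **THE SANDWICH TERM WITH A FAR FACTOR**: leaf-03's `biLoc_sandwich_sub` for second tables whose constant AND deviation carry
the same factor `e^{−m s}` (the far factor of a bi-stencil family at the first bond): the factor survives in the constant. -/
theorem biLoc_sandwich_sub_far {K K' : MKer (d + 1) (Fib d)} {C εK m : ℝ} (hK : Decays K C m) (hK' : Decays K' C m)
    (hKK : Decays (K - K') εK m) (hm : 0 < m) {V V' : MKer (d + 1) (Fib d)} {CV εV s : ℝ} {p : Fin (d + 1) → ℤ}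
    (hV : BiLoc V p p (CV * Real.exp (-m * s)) m) (hV' : BiLoc V' p p (CV * Real.exp (-m * s)) m)
    (hVV : BiLoc (V - V') p p (εV * Real.exp (-m * s)) m) :
    BiLoc (comp (comp K V) K - comp (comp K' V') K') p p (lSand d C CV εK εV m * Real.exp (-m * s)) (m / 4) := by
  have h := biLoc_sandwich_sub hK hK' hKK hm hV hV' hVV
  rw [lSand_mul_far] at h
  exact h

end Parts

/-! ## §2 The product term `K∘dM_b∘K2OfK_{b′}` is Lipschitz (bond pair `(N•y, N•y′)`, rate `m/8`, far factor `m/16`) -/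

section Prod

variable {N : ℕ} [NeZero N]

/-- [folklore] The Lipschitz constant of the product term (coefficient of the far factor `e^{−(m/16)|N•y − N•y′|₁}`): asym1's
`biLoc_comp_sub_comp_bb` constant over the factors `K∘dM_b` (`cdM`; deviation `ldM`) and `K2OfK_{b′}` (`cK2`; deviation `lK2`); LINEAR in `(εK, εS, εM)`. -/
def lProd (d : ℕ) (C Cs CM εK εS εM m : ℝ) : ℝ :=
  (Fintype.card (Fib d) : ℝ) *
      (((Fintype.card (Fib d) : ℝ) * (εK * cdM d C Cs CM m) * Zl (d + 1) (m / 4)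
          + (Fintype.card (Fib d) : ℝ) * (C * ldM d C Cs CM εK εS εM m) * Zl (d + 1) (m / 4))
        * cK2 d C Cs CM m) * Zl (d + 1) (m / 16)
    + (Fintype.card (Fib d) : ℝ) *
      (((Fintype.card (Fib d) : ℝ) * (C * cdM d C Cs CM m) * Zl (d + 1) (m / 4)) * lK2 d C Cs CM εK εS εM m) * Zl (d + 1) (m / 16)

/-- [folklore] `lProd` is nonnegative for nonnegative inputs. -/
theorem lProd_nonneg {C Cs CM εK εS εM m : ℝ} (hC : 0 ≤ C) (hCs : 0 ≤ Cs) (hCM : 0 ≤ CM) (hεK : 0 ≤ εK) (hεS : 0 ≤ εS)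
    (hεM : 0 ≤ εM) (hm : 0 < m) : 0 ≤ lProd d C Cs CM εK εS εM m := by
  unfold lProd
  have h1 := cdM_nonneg (d := d) hC hCs hCM hm
  have h2 := cK2_nonneg (d := d) hC hCs hCM hm
  have h3 := ldM_nonneg (d := d) hC hCs hCM hεK hεS hεM hm
  have h4 := lK2_nonneg (d := d) hC hCs hCM hεK hεS hεM hm
  have h5 := Zl_nonneg (D := d + 1) (show 0 < m / 4 by positivity)
  have h6 := Zl_nonneg (D := d + 1) (show 0 < m / 16 by positivity)
  positivity

/-- [folklore] **THE PRODUCT TERM IS LIPSCHITZ IN `(K, S, M)`**: for packed kernels `K, K′` decaying at rate `m` (constant `C`, deviation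
`εK`) and first tables `S, S′` ∕ `M, M′` localised at rate `m` (constants `Cs`, `CM`, deviations `εS`, `εM`), the product term of `K3OfK` at the
bond pair `((μ, y), (ν, y′))` differs between the two data by a kernel bi-localised at `(N•y, N•y′)`, rate `m/8`, constant
`lProd · e^{−(m/16)|N•y − N•y′|₁}` (an2's product-term bound of `biLoc_K3OfK_far` one order of differences up). -/
theorem biLoc_prod_sub {K K' : MKer (d + 1) (Fib d)} {C εK m : ℝ} (hK : Decays K C m) (hK' : Decays K' C m)
    (hKK : Decays (K - K') εK m) (hm : 0 < m)
    {S S' : Fin (d + 1) → (Fin (d + 1) → ℤ) → MKer (d + 1) (Fib d)} {Cs εS : ℝ}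
    {M M' : Fin (d + 1) → (Fin (d + 1) → ℤ) → MKer (d + 1) (Fib d)} {CM εM : ℝ}
    (hS : LocStencil S Cs m) (hS' : LocStencil S' Cs m) (hSS : LocStencil (S - S') εS m)
    (hM : VertexFamily M N CM m) (hM' : VertexFamily M' N CM m) (hMM : VertexFamily (M - M') N εM m)
    (μ : Fin (d + 1)) (y : Fin (d + 1) → ℤ) (ν : Fin (d + 1)) (y' : Fin (d + 1) → ℤ) :
    BiLoc (comp (comp K (dM K N S M μ y)) (K2OfK K N S M ν y') - comp (comp K' (dM K' N S' M' μ y)) (K2OfK K' N S' M' ν y'))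
      ((N : ℤ) • y) ((N : ℤ) • y') (lProd d C Cs CM εK εS εM m * Real.exp (-(m / 16) * l1 ((N : ℤ) • y - (N : ℤ) • y'))) (m / 8) := by
  have hC : 0 ≤ C := hK.nonneg (Sum.inl 0)
  have hεK : 0 ≤ εK := hKK.nonneg (Sum.inl 0)
  have hCs : 0 ≤ Cs := (hS 0 0).nonneg (Sum.inl 0)
  have hεS : 0 ≤ εS := (hSS 0 0).nonneg (Sum.inl 0)
  have hCM : 0 ≤ CM := (hM 0 0).nonneg (Sum.inl 0)
  have hεM : 0 ≤ εM := (hMM 0 0).nonneg (Sum.inl 0)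
  have hcdM : 0 ≤ cdM d C Cs CM m := cdM_nonneg hC hCs hCM hm
  have hldM : 0 ≤ ldM d C Cs CM εK εS εM m := ldM_nonneg hC hCs hCM hεK hεS hεM hm
  have hZ4 : 0 ≤ Zl (d + 1) (m / 4) := Zl_nonneg (D := d + 1) (show 0 < m / 4 by positivity)
  have hKm2 : Decays K C (m / 2) := decays_mono hK hC le_rfl (by linarith)
  have hK'm2 : Decays K' C (m / 2) := decays_mono hK' hC le_rfl (by linarith)
  have hKKm2 : Decays (K - K') εK (m / 2) := decays_mono hKK hεK le_rfl (by linarith)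
  -- the `dM` factors at the first bond, rate `m/2`
  have hD : BiLoc (dM K N S M μ y) ((N : ℤ) • y) ((N : ℤ) • y) (cdM d C Cs CM m) (m / 2) :=
    vertexFamily_dM hK hC hS hM hm le_rfl μ y
  have hD' : BiLoc (dM K' N S' M' μ y) ((N : ℤ) • y) ((N : ℤ) • y) (cdM d C Cs CM m) (m / 2) :=
    vertexFamily_dM hK' hC hS' hM' hm le_rfl μ y
  have hDD : BiLoc (dM K N S M μ y - dM K' N S' M' μ y) ((N : ℤ) • y) ((N : ℤ) • y) (ldM d C Cs CM εK εS εM m) (m / 2) :=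
    vertexFamily_dM_sub hK hK' hKK hS hS' hSS hM hM' hMM hm le_rfl μ y
  -- the factor `X = K ∘ dM_b` at the first bond, rate `m/4`, weakened to `m/8`
  have hX : BiLoc (comp K (dM K N S M μ y)) ((N : ℤ) • y) ((N : ℤ) • y)
      ((Fintype.card (Fib d) : ℝ) * (C * cdM d C Cs CM m) * Zl (d + 1) (m / 4)) (m / 8) := by
    have h := biLoc_comp_decays hKm2 hD (show (0 : ℝ) ≤ m / 4 by positivity) (by linarith)
    rw [show m / 2 - m / 4 = m / 4 by ring] at h
    exact biLoc_mono h (by positivity) (by linarith)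
  have hX' : BiLoc (comp K' (dM K' N S' M' μ y)) ((N : ℤ) • y) ((N : ℤ) • y)
      ((Fintype.card (Fib d) : ℝ) * (C * cdM d C Cs CM m) * Zl (d + 1) (m / 4)) (m / 8) := by
    have h := biLoc_comp_decays hK'm2 hD' (show (0 : ℝ) ≤ m / 4 by positivity) (by linarith)
    rw [show m / 2 - m / 4 = m / 4 by ring] at h
    exact biLoc_mono h (by positivity) (by linarith)
  have hXX : BiLoc (comp K (dM K N S M μ y) - comp K' (dM K' N S' M' μ y)) ((N : ℤ) • y) ((N : ℤ) • y)
      ((Fintype.card (Fib d) : ℝ) * (εK * cdM d C Cs CM m) * Zl (d + 1) (m / 4)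
        + (Fintype.card (Fib d) : ℝ) * (C * ldM d C Cs CM εK εS εM m) * Zl (d + 1) (m / 4)) (m / 8) := by
    have h := biLoc_comp_sub_comp hKm2 hK'm2 hKKm2 hD hD' hDD (half_pos hm)
    rw [show m / 2 - m / 2 / 2 = m / 4 by ring] at h
    exact biLoc_mono h (by positivity) (by linarith)
  -- the factor `Y = K2OfK_{b′}` at the second bond, rate `m/8`
  have hY : BiLoc (K2OfK K N S M ν y') ((N : ℤ) • y') ((N : ℤ) • y') (cK2 d C Cs CM m) (m / 8) :=
    vertexFamily_K2OfK hK hC hm hS hM ν y'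
  have hY' : BiLoc (K2OfK K' N S' M' ν y') ((N : ℤ) • y') ((N : ℤ) • y') (cK2 d C Cs CM m) (m / 8) :=
    vertexFamily_K2OfK hK' hC hm hS' hM' ν y'
  have hYY : BiLoc (K2OfK K N S M ν y' - K2OfK K' N S' M' ν y') ((N : ℤ) • y') ((N : ℤ) • y') (lK2 d C Cs CM εK εS εM m) (m / 8) :=
    vertexFamily_K2OfK_sub hK hK' hKK hm hS hS' hSS hM hM' hMM ν y'
  have h := biLoc_comp_sub_comp_bb hX hX' hXX hY hY' hYY (show (0 : ℝ) < m / 8 by positivity)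
  rw [show m / 8 / 2 = m / 16 by ring] at h
  intro x z a b
  refine (h x z a b).trans (le_of_eq ?_)
  unfold lProd
  ring

end Prod

/-! ## §3 THE ENGINE: `K3OfK` is Lipschitz in `(K, S, M, W)` — far form at the first coarse bond -/

section K3

variable {N : ℕ} [NeZero N]

/-- [folklore] **THE LIPSCHITZ CONSTANT OF `K3OfK`** (coefficient of the far factor `e^{−(m/32)|N•y′ − N•y|₁}`; rate `m` in, `m/32` out): twice
`lProd` plus leaf-03's sandwich constant `lSand` over the second tables' (constant `Cw`, deviation `εW`); LINEAR in `(εK, εS, εM, εW)`. -/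
def lK3 (d : ℕ) (C Cs CM Cw εK εS εM εW m : ℝ) : ℝ :=
  lProd d C Cs CM εK εS εM m + lProd d C Cs CM εK εS εM m + lSand d C Cw εK εW m

/-- [folklore] `lK3` is nonnegative for nonnegative inputs. -/
theorem lK3_nonneg {C Cs CM Cw εK εS εM εW m : ℝ} (hC : 0 ≤ C) (hCs : 0 ≤ Cs) (hCM : 0 ≤ CM) (hCw : 0 ≤ Cw) (hεK : 0 ≤ εK)
    (hεS : 0 ≤ εS) (hεM : 0 ≤ εM) (hεW : 0 ≤ εW) (hm : 0 < m) : 0 ≤ lK3 d C Cs CM Cw εK εS εM εW m := by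
  unfold lK3
  have h1 := lProd_nonneg (d := d) hC hCs hCM hεK hεS hεM hm
  have h2 := lSand_nonneg (d := d) hC hCw hεK hεW hm
  positivity

/-- [folklore] **LINEARITY OF THE LIPSCHITZ CONSTANT IN THE DEVIATIONS**: scaling all four deviations by `t` scales `lK3` by `t` (how
geometric data deviations `c·θ^k` become geometric read-out deviations; leaf-03's `LW2_mul` pattern). -/
theorem lK3_mul (d : ℕ) (C Cs CM Cw εK εS εM εW m t : ℝ) :
    lK3 d C Cs CM Cw (εK * t) (εS * t) (εM * t) (εW * t) m = lK3 d C Cs CM Cw εK εS εM εW m * t := by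
  simp only [lK3, lProd, ldM, lK2, lSand]
  ring

/-- [folklore] **`K3OfK` IS LIPSCHITZ IN `(K, S, M, W)` — FAR FORM AT THE FIRST COARSE BOND** (an2's `biLoc_K3OfK_far`, one order of
differences up).  Data: packed kernels `K, K′` decaying at rate `m` (constant `C`, deviation `Decays (K − K′) εK m`); first tables `S, S′`
(`LocStencil`, constant `Cs`, deviation `εS`) and `M, M′` (`VertexFamily`, constant `CM`, deviation `εM`) at rate `m`; second tables `W, W′`
bi-localised at the first bond `N•y` with a constant decaying at rate `m` in `|N•y′ − N•y|₁` (amplitude `Cw`, deviation amplitude `εW`).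
Conclusion: `K3OfK K N S M W b b′ − K3OfK K′ N S′ M′ W′ b b′` is bi-localised at `N•y`, rate `m/32`, constant
`lK3 d C Cs CM Cw εK εS εM εW m · e^{−(m/32)|N•y′ − N•y|₁}` (product terms: `biLoc_prod_sub` + an2's `biLoc_recenter_right∕left`; sandwich
term: `biLoc_sandwich_sub_far`; assembled by `biLoc_K3OfK_sub_of_parts`).  Rates explicit; no optimality claimed. -/
theorem biLoc_K3OfK_sub_far {K K' : MKer (d + 1) (Fib d)} {C εK m : ℝ} (hK : Decays K C m) (hK' : Decays K' C m)
    (hKK : Decays (K - K') εK m) (hm : 0 < m)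
    {S S' : Fin (d + 1) → (Fin (d + 1) → ℤ) → MKer (d + 1) (Fib d)} {Cs εS : ℝ}
    {M M' : Fin (d + 1) → (Fin (d + 1) → ℤ) → MKer (d + 1) (Fib d)} {CM εM : ℝ}
    (hS : LocStencil S Cs m) (hS' : LocStencil S' Cs m) (hSS : LocStencil (S - S') εS m)
    (hM : VertexFamily M N CM m) (hM' : VertexFamily M' N CM m) (hMM : VertexFamily (M - M') N εM m)
    {W W' : Fin (d + 1) → (Fin (d + 1) → ℤ) → Fin (d + 1) → (Fin (d + 1) → ℤ) → MKer (d + 1) (Fib d)} {Cw εW : ℝ}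
    (hCw : 0 ≤ Cw) (hεW : 0 ≤ εW)
    (hW : ∀ (μ : Fin (d + 1)) (y : Fin (d + 1) → ℤ) (ν : Fin (d + 1)) (y' : Fin (d + 1) → ℤ),
      BiLoc (W μ y ν y') ((N : ℤ) • y) ((N : ℤ) • y) (Cw * Real.exp (-m * l1 ((N : ℤ) • y' - (N : ℤ) • y))) m)
    (hW' : ∀ (μ : Fin (d + 1)) (y : Fin (d + 1) → ℤ) (ν : Fin (d + 1)) (y' : Fin (d + 1) → ℤ),
      BiLoc (W' μ y ν y') ((N : ℤ) • y) ((N : ℤ) • y) (Cw * Real.exp (-m * l1 ((N : ℤ) • y' - (N : ℤ) • y))) m)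
    (hWW : ∀ (μ : Fin (d + 1)) (y : Fin (d + 1) → ℤ) (ν : Fin (d + 1)) (y' : Fin (d + 1) → ℤ),
      BiLoc (W μ y ν y' - W' μ y ν y') ((N : ℤ) • y) ((N : ℤ) • y) (εW * Real.exp (-m * l1 ((N : ℤ) • y' - (N : ℤ) • y))) m)
    (μ : Fin (d + 1)) (y : Fin (d + 1) → ℤ) (ν : Fin (d + 1)) (y' : Fin (d + 1) → ℤ) :
    BiLoc (K3OfK K N S M W μ y ν y' - K3OfK K' N S' M' W' μ y ν y') ((N : ℤ) • y) ((N : ℤ) • y)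
      (lK3 d C Cs CM Cw εK εS εM εW m * Real.exp (-(m / 32) * l1 ((N : ℤ) • y' - (N : ℤ) • y))) (m / 32) := by
  have hC : 0 ≤ C := hK.nonneg (Sum.inl 0)
  have hεK : 0 ≤ εK := hKK.nonneg (Sum.inl 0)
  have hCs : 0 ≤ Cs := (hS 0 0).nonneg (Sum.inl 0)
  have hεS : 0 ≤ εS := (hSS 0 0).nonneg (Sum.inl 0)
  have hCM : 0 ≤ CM := (hM 0 0).nonneg (Sum.inl 0)
  have hεM : 0 ≤ εM := (hMM 0 0).nonneg (Sum.inl 0)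
  have hP : 0 ≤ lProd d C Cs CM εK εS εM m := lProd_nonneg hC hCs hCM hεK hεS hεM hm
  have hL : 0 ≤ lSand d C Cw εK εW m := lSand_nonneg hC hCw hεK hεW hm
  -- term A: the product term at `(N•y, N•y′)`, re-centred to `(N•y, N•y)`
  have hA : BiLoc (comp (comp K (dM K N S M μ y)) (K2OfK K N S M ν y') - comp (comp K' (dM K' N S' M' μ y)) (K2OfK K' N S' M' ν y'))
      ((N : ℤ) • y) ((N : ℤ) • y) (lProd d C Cs CM εK εS εM m * Real.exp (-(m / 32) * l1 ((N : ℤ) • y' - (N : ℤ) • y))) (m / 32) := by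
    have h' : BiLoc (comp (comp K (dM K N S M μ y)) (K2OfK K N S M ν y')
          - comp (comp K' (dM K' N S' M' μ y)) (K2OfK K' N S' M' ν y')) ((N : ℤ) • y) ((N : ℤ) • y')
        (lProd d C Cs CM εK εS εM m * Real.exp (-(m / 32) * l1 ((N : ℤ) • y' - (N : ℤ) • y))
          * Real.exp (-(m / 32) * l1 ((N : ℤ) • y - (N : ℤ) • y'))) (m / 32) := by
      refine biLoc_le_mono (biLoc_prod_sub hK hK' hKK hm hS hS' hSS hM hM' hMM μ y ν y') (by positivity) ?_ (by linarith)
      rw [l1_sub_symm ((N : ℤ) • y') ((N : ℤ) • y), mul_assoc, ← Real.exp_add]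
      exact mul_le_mul_of_nonneg_left (Real.exp_le_exp.2 (by nlinarith [l1_nonneg ((N : ℤ) • y - (N : ℤ) • y')])) hP
    exact biLoc_recenter_right h' (by positivity) (by positivity) le_rfl
  -- term B: the swapped product term at `(N•y′, N•y)`, re-centred to `(N•y, N•y)`
  have hB : BiLoc (comp (comp K (dM K N S M ν y')) (K2OfK K N S M μ y) - comp (comp K' (dM K' N S' M' ν y')) (K2OfK K' N S' M' μ y))
      ((N : ℤ) • y) ((N : ℤ) • y) (lProd d C Cs CM εK εS εM m * Real.exp (-(m / 32) * l1 ((N : ℤ) • y' - (N : ℤ) • y))) (m / 32) := by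
    have h' : BiLoc (comp (comp K (dM K N S M ν y')) (K2OfK K N S M μ y)
          - comp (comp K' (dM K' N S' M' ν y')) (K2OfK K' N S' M' μ y)) ((N : ℤ) • y') ((N : ℤ) • y)
        (lProd d C Cs CM εK εS εM m * Real.exp (-(m / 32) * l1 ((N : ℤ) • y' - (N : ℤ) • y))
          * Real.exp (-(m / 32) * l1 ((N : ℤ) • y - (N : ℤ) • y'))) (m / 32) := by
      refine biLoc_le_mono (biLoc_prod_sub hK hK' hKK hm hS hS' hSS hM hM' hMM ν y' μ y) (by positivity) ?_ (by linarith)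
      rw [mul_assoc, ← Real.exp_add, l1_sub_symm ((N : ℤ) • y) ((N : ℤ) • y')]
      exact mul_le_mul_of_nonneg_left (Real.exp_le_exp.2 (by nlinarith [l1_nonneg ((N : ℤ) • y' - (N : ℤ) • y)])) hP
    exact biLoc_recenter_left h' (by positivity) (by positivity) le_rfl
  -- the sandwich term, weakened from rate `m/4` (far rate `m`) to `m/32`
  have hG : BiLoc (comp (comp K (W μ y ν y')) K - comp (comp K' (W' μ y ν y')) K') ((N : ℤ) • y) ((N : ℤ) • y)
      (lSand d C Cw εK εW m * Real.exp (-(m / 32) * l1 ((N : ℤ) • y' - (N : ℤ) • y))) (m / 32) := by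
    have h := biLoc_sandwich_sub_far hK hK' hKK hm (hW μ y ν y') (hW' μ y ν y') (hWW μ y ν y')
    refine biLoc_le_mono h (by positivity) ?_ (by linarith)
    exact mul_le_mul_of_nonneg_left (Real.exp_le_exp.2 (by nlinarith [l1_nonneg ((N : ℤ) • y' - (N : ℤ) • y)])) hL
  have e : lProd d C Cs CM εK εS εM m * Real.exp (-(m / 32) * l1 ((N : ℤ) • y' - (N : ℤ) • y))
        + lProd d C Cs CM εK εS εM m * Real.exp (-(m / 32) * l1 ((N : ℤ) • y' - (N : ℤ) • y))
        + lSand d C Cw εK εW m * Real.exp (-(m / 32) * l1 ((N : ℤ) • y' - (N : ℤ) • y))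
      = lK3 d C Cs CM Cw εK εS εM εW m * Real.exp (-(m / 32) * l1 ((N : ℤ) • y' - (N : ℤ) • y)) := by
    unfold lK3; ring
  rw [← e]
  exact biLoc_K3OfK_sub_of_parts hA hB hG

end K3

/-! ## §4 The read-out form (`LocStencil₂` currency) and the family (Cauchy) form -/

section ReadOut

variable {Lc : ℕ} [NeZero Lc]

/-- [folklore] **THE VALUE READ-OUT IS LIPSCHITZ IN `(K, S, M, W)`** (leaf-19's `T2SlotOfHW.locStencil₂_mmRead_K3OfK_family` one order of
differences up).  Data at the common rate `m`: `K, K′` (`Decays`, constant `C`, deviation `εK`), `S, S′` ∕ `M, M′` (`LocStencil` ∕ `VertexFamily`,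
constants `Cs`, `CM`, deviations `εS`, `εM`), second tables `W, W′` in PAIR FORM (`VertexFamily₂`, constant `Cw`, deviation
`VertexFamily₂ (W − W′) Lc εW m`) with the `(μy)↔(νy′)` swap symmetry (leaf-19's `unitW_WbalOf_swap` shape).  Conclusion:
`LocStencil₂ (mmRead Lc ∘ K3OfK K Lc S M W − mmRead Lc ∘ K3OfK K′ Lc S′ M′ W′) (lK3 d C Cs CM Cw εK εS εM εW (m/4)) (m/128)` — data weakened to
`m/4`, far forms by an2's `biLoc_far_of_pair`, `biLoc_K3OfK_sub_far` at rate `m/4`, an2's `biLoc_mmRead`, leaf-13's `ThirdJetKernel.mmRead_sub`. -/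
theorem locStencil₂_mmRead_K3OfK_sub (hLc : 1 ≤ Lc) {K K' : MKer (d + 1) (Fib d)} {C εK m : ℝ} (hK : Decays K C m)
    (hK' : Decays K' C m) (hKK : Decays (K - K') εK m) (hm : 0 < m)
    {S S' : Fin (d + 1) → (Fin (d + 1) → ℤ) → MKer (d + 1) (Fib d)} {Cs εS : ℝ}
    {M M' : Fin (d + 1) → (Fin (d + 1) → ℤ) → MKer (d + 1) (Fib d)} {CM εM : ℝ}
    (hS : LocStencil S Cs m) (hS' : LocStencil S' Cs m) (hSS : LocStencil (S - S') εS m)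
    (hM : VertexFamily M Lc CM m) (hM' : VertexFamily M' Lc CM m) (hMM : VertexFamily (M - M') Lc εM m)
    {W W' : Fin (d + 1) → (Fin (d + 1) → ℤ) → Fin (d + 1) → (Fin (d + 1) → ℤ) → MKer (d + 1) (Fib d)} {Cw εW : ℝ}
    (hW : VertexFamily₂ W Lc Cw m) (hW' : VertexFamily₂ W' Lc Cw m) (hWW : VertexFamily₂ (W - W') Lc εW m)
    (hWs : ∀ μ y ν y', W ν y' μ y = W μ y ν y') (hW's : ∀ μ y ν y', W' ν y' μ y = W' μ y ν y') :
    LocStencil₂ (fun κ u κ' u' => mmRead Lc (K3OfK K Lc S M W κ u κ' u') - mmRead Lc (K3OfK K' Lc S' M' W' κ u κ' u'))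
      (lK3 d C Cs CM Cw εK εS εM εW (m / 4)) (m / 128) := by
  have hC : 0 ≤ C := hK.nonneg (Sum.inl 0)
  have hεK : 0 ≤ εK := hKK.nonneg (Sum.inl 0)
  have hCs : 0 ≤ Cs := (hS 0 0).nonneg (Sum.inl 0)
  have hεS : 0 ≤ εS := (hSS 0 0).nonneg (Sum.inl 0)
  have hCM : 0 ≤ CM := (hM 0 0).nonneg (Sum.inl 0)
  have hεM : 0 ≤ εM := (hMM 0 0).nonneg (Sum.inl 0)
  have hCw : 0 ≤ Cw := (hW 0 0 0 0).nonneg (Sum.inl 0)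
  have hεW : 0 ≤ εW := (hWW 0 0 0 0).nonneg (Sum.inl 0)
  have hm4 : 0 < m / 4 := by positivity
  have hL : 0 ≤ lK3 d C Cs CM Cw εK εS εM εW (m / 4) := lK3_nonneg hC hCs hCM hCw hεK hεS hεM hεW hm4
  -- all data at the weaker rate `m/4`
  have hK4 : Decays K C (m / 4) := decays_mono hK hC le_rfl (by linarith)
  have hK'4 : Decays K' C (m / 4) := decays_mono hK' hC le_rfl (by linarith)
  have hKK4 : Decays (K - K') εK (m / 4) := decays_mono hKK hεK le_rfl (by linarith)
  have hS4 : LocStencil S Cs (m / 4) := locStencil_mono hS hCs (by linarith)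
  have hS'4 : LocStencil S' Cs (m / 4) := locStencil_mono hS' hCs (by linarith)
  have hSS4 : LocStencil (S - S') εS (m / 4) := locStencil_mono hSS hεS (by linarith)
  have hM4 : VertexFamily M Lc CM (m / 4) := vertexFamily_mono' hM hCM (by linarith)
  have hM'4 : VertexFamily M' Lc CM (m / 4) := vertexFamily_mono' hM' hCM (by linarith)
  have hMM4 : VertexFamily (M - M') Lc εM (m / 4) := vertexFamily_mono' hMM hεM (by linarith)
  -- far forms of the second tables (pair + swap ⟹ far-small at the first bond, rate `m/4`, far rate weakened to `m/4`)
  have far : ∀ {V : Fin (d + 1) → (Fin (d + 1) → ℤ) → Fin (d + 1) → (Fin (d + 1) → ℤ) → MKer (d + 1) (Fib d)} {Cv : ℝ},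
      0 ≤ Cv → VertexFamily₂ V Lc Cv m → (∀ μ y ν y', V ν y' μ y = V μ y ν y') →
      ∀ (μ : Fin (d + 1)) (y : Fin (d + 1) → ℤ) (ν : Fin (d + 1)) (y' : Fin (d + 1) → ℤ),
        BiLoc (V μ y ν y') ((Lc : ℤ) • y) ((Lc : ℤ) • y) (Cv * Real.exp (-(m / 4) * l1 ((Lc : ℤ) • y' - (Lc : ℤ) • y))) (m / 4) := by
    intro V Cv hCv hV hVs μ y ν y'
    have h2 : BiLoc (V μ y ν y') ((Lc : ℤ) • y') ((Lc : ℤ) • y) Cv m := by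
      rw [← hVs μ y ν y']
      exact hV ν y' μ y
    refine biLoc_le_mono (biLoc_far_of_pair (hV μ y ν y') h2 hm.le) (by positivity) ?_ le_rfl
    exact mul_le_mul_of_nonneg_left (Real.exp_le_exp.2 (by nlinarith [l1_nonneg ((Lc : ℤ) • y' - (Lc : ℤ) • y)])) hCv
  have hWWs : ∀ μ y ν y', (W - W') ν y' μ y = (W - W') μ y ν y' := by
    intro μ y ν y'
    simp only [Pi.sub_apply, hWs μ y ν y', hW's μ y ν y']
  have hWfar := far hCw hW hWs
  have hW'far := far hCw hW' hW's
  have hWWfar := far hεW hWW hWWs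
  intro κ u κ' u'
  have h := biLoc_K3OfK_sub_far hK4 hK'4 hKK4 hm4 hS4 hS'4 hSS4 hM4 hM'4 hMM4 hCw hεW hWfar hW'far hWWfar κ u κ' u'
  have h' : BiLoc (K3OfK K Lc S M W κ u κ' u' - K3OfK K' Lc S' M' W' κ u κ' u') ((Lc : ℤ) • u) ((Lc : ℤ) • u)
      (lK3 d C Cs CM Cw εK εS εM εW (m / 4) * Real.exp (-(m / 128) * l1 (u' - u))) (m / 128) := by
    refine biLoc_le_mono h (by positivity) ?_ (by linarith)
    rw [show m / 4 / 32 = m / 128 by ring]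
    exact mul_le_mul_of_nonneg_left (Real.exp_le_exp.2 (by nlinarith [l1_sub_le_l1_smul_sub hLc u' u, hm4])) hL
  show BiLoc (mmRead Lc (K3OfK K Lc S M W κ u κ' u') - mmRead Lc (K3OfK K' Lc S' M' W' κ u κ' u')) u u
    (lK3 d C Cs CM Cw εK εS εM εW (m / 4) * Real.exp (-(m / 128) * l1 (u' - u))) (m / 128)
  rw [← mmRead_sub]
  exact biLoc_mmRead hLc h' (by positivity)

/-- [folklore] **CAUCHY FORM: GEOMETRICALLY CONVERGENT DATA ⟹ GEOMETRICALLY CONVERGENT VALUE READ-OUTS** (leaf-03's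
`vertexFamily₂_W2SymOfK_cauchy` pattern): families with `j`-UNIFORM localisation data (`C, Cs, CM, Cw` at rate `m`) whose members `k+j` and `k`
differ by deviations `cK·θ^k`, `cS·θ^k`, `cM·θ^k`, `cW·θ^k` (second tables swap-symmetric) have read-outs `mmRead Lc ∘ K3OfK` differing by a
`LocStencil₂` family with constant `lK3 (…, cK, cS, cM, cW, m/4)·θ^k`, rate `m/128`; no sign or size condition on `θ` is used. -/
theorem mmRead_K3OfK_cauchy (hLc : 1 ≤ Lc) {K : ℕ → MKer (d + 1) (Fib d)}
    {S M : ℕ → Fin (d + 1) → (Fin (d + 1) → ℤ) → MKer (d + 1) (Fib d)}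
    {W : ℕ → Fin (d + 1) → (Fin (d + 1) → ℤ) → Fin (d + 1) → (Fin (d + 1) → ℤ) → MKer (d + 1) (Fib d)}
    {C Cs CM Cw cK cS cM cW m θ : ℝ} (hm : 0 < m)
    (hK : ∀ j, Decays (K j) C m) (hKc : ∀ k j, Decays (K (k + j) - K k) (cK * θ ^ k) m)
    (hS : ∀ j, LocStencil (S j) Cs m) (hSc : ∀ k j, LocStencil (S (k + j) - S k) (cS * θ ^ k) m)
    (hM : ∀ j, VertexFamily (M j) Lc CM m) (hMc : ∀ k j, VertexFamily (M (k + j) - M k) Lc (cM * θ ^ k) m)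
    (hW : ∀ j, VertexFamily₂ (W j) Lc Cw m) (hWc : ∀ k j, VertexFamily₂ (W (k + j) - W k) Lc (cW * θ ^ k) m)
    (hWs : ∀ j μ y ν y', W j ν y' μ y = W j μ y ν y') (k j : ℕ) :
    LocStencil₂ (fun κ u κ' u' => mmRead Lc (K3OfK (K (k + j)) Lc (S (k + j)) (M (k + j)) (W (k + j)) κ u κ' u')
        - mmRead Lc (K3OfK (K k) Lc (S k) (M k) (W k) κ u κ' u')) (lK3 d C Cs CM Cw cK cS cM cW (m / 4) * θ ^ k) (m / 128) := by
  have h := locStencil₂_mmRead_K3OfK_sub hLc (hK (k + j)) (hK k) (hKc k j) hm (hS (k + j)) (hS k) (hSc k j) (hM (k + j)) (hM k)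
    (hMc k j) (hW (k + j)) (hW k) (hWc k j) (hWs (k + j)) (hWs k)
  rw [lK3_mul] at h
  exact h

end ReadOut

end Summit.QuantumFields.BalabanUV.Beta.GAN24.ValueReadoutLipschitz

end
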